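import Mathlib
import Summits.Ventures.PercRepro2.SepFarA3Gen
import Summits.Ventures.PercRepro2.SepRealGen

/-!
# Gluing at a general separator, III: ANY one mark alone behind a separator `σ : ι → V` — the
typed one-far-mark rule for every far mark and every separator size in one theorem (blind cell
PercRepro2, mine-2 g47, 2026-08-29; `conjectures/MINE-2.md` M2-97)

The five marks are a vector `mk : Fin 5 → V` (`0 = o, 1 = a₁, 2 = a₂, 3 = a₃, 4 = b`) and the far
mark is an index `far : Fin 5`.  CLASS (`SepFarAny`): the support graph `z ∪ F` splits into a root
side `VH` holding the four other marks and a far side `VL ∋ mk far`, the intersection covered by the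
separator vertices, no typed edge inside both sides, `mk far` not a separator vertex.  The root-side
data (`rootDataA`: the connections inside `VH` among the marks, from the separator to the marks,
and among the separator vertices) and the far pattern (`fpG`) determine every copy's state
(`st_eq_gluedAny`): a connection between two root-side marks runs inside `VH` or through a glued pair
of separator vertices, a connection to the far mark enters the far side through a glued separator
vertex (`conn_iff_connA`, by `conn_sideG` / `conn_crossG`).  Sorting the copies by their pattern
triple gives the identity `typedCount_eq_sepFarAny` and the rule on the realised orbits
`typedCount_nonneg_of_sepFarAny_realised`: **row 2′TRI holds whenever one mark sits alone behind a
separator of any size and every REALISED `S₃`-orbit sum of the glued root counts is nonnegative**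
(`typedCount_nonneg_of_sepFarAny_real`: the same with the hypothesis over the REAL pattern triples,
the set partitions of the separator vertices and the far mark).
`SepFarA3Gen` is the case `far = 3` with the marks named; the five 2-separator rules of
`TwoSepFarRule` and the cut-vertex rules `CutFarA3 / CutFarMarkO / CutFarMarkB / CutFarRoot` are the
cases `|ι| = 2`, `|ι| = 1`.  Own work; standard axioms.
-/

namespace Summit.Ventures.PercRepro2

open UnionCluster

namespace CovForm

namespace RootBridge

open OneTyped TypedA3 Untouched TypedFactor Separated

/-! ## The root-side data and the glued state for an arbitrary far mark -/

section States

open Classical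

variable {ι : Type*}

/-- The root-side data of a copy at a separator indexed by `ι`, for the five marks `Fin 5`: the
connections inside the root side among the marks, from the separator vertices to the marks, and
among the separator vertices (entries involving the far mark are never read). -/
structure RootDataAny (ι : Type*) where
  /-- `mk k ↔ mk l` -/
  mm : Fin 5 → Fin 5 → Bool
  /-- `σ i ↔ mk k` -/
  sm : ι → Fin 5 → Bool
  /-- `σ i ↔ σ j` -/
  ss : ι → ι → Bool

/-- The glue relation read off the data: the closure of «joined inside the root side or inside
the far side». -/
def glueDA (h : RootDataAny ι) (p : FPG ι) (i j : ι) : Prop :=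
  Relation.ReflTransGen (fun i j => h.ss i j = true ∨ p.1 i j = true) i j

/-- **The glued connection** between the marks `k` and `l` when `far` is the far mark: through the
glued separator to the far side when one of them is the far mark, directly or through a glued pair
of separator vertices otherwise. -/
def connA (h : RootDataAny ι) (p : FPG ι) (far k l : Fin 5) : Prop :=
  if k = far then ∃ i j, h.sm i l = true ∧ glueDA h p i j ∧ p.2 j = true
  else if l = far then ∃ i j, h.sm i k = true ∧ glueDA h p i j ∧ p.2 j = true
  else h.mm k l = true ∨ ∃ i j, h.sm i k = true ∧ glueDA h p i j ∧ h.sm j l = true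

/-- **The glued state**: the seven kernel coordinates `(a₂a₁, a₁o, a₂o, a₁b, a₂b, a₁a₃, a₂a₃)`
read through the glued connection. -/
noncomputable def gluedAny (h : RootDataAny ι) (p : FPG ι) (far : Fin 5) : St :=
  (decide (connA h p far 2 1), decide (connA h p far 1 0), decide (connA h p far 2 0),
    decide (connA h p far 1 4), decide (connA h p far 2 4), decide (connA h p far 1 3),
    decide (connA h p far 2 3))

end States

/-! ## The class, the states of the support and the identity -/

section Main

open Classical

variable {V : Type*} {E : Type*} {ι : Type*} [Fintype E] [DecidableEq E] {R : Type*} [Field R]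
  [LinearOrder R] [IsStrictOrderedRing R]
variable (ends : E → Sym2 V) (mk : Fin 5 → V) (σ : ι → V)

/-- The root-side data of a configuration (read on the root-side restriction). -/
noncomputable def rootDataA (y : Config E) : RootDataAny ι :=
  ⟨fun k l => decide (Conn ends y (mk k) (mk l)), fun i k => decide (Conn ends y (σ i) (mk k)),
    fun i j => decide (Conn ends y (σ i) (σ j))⟩

/-- **The mark `mk far` alone behind the separator `σ`**: the support graph `z ∪ F` splits into a
root side `VH` holding the other four marks and a far side `VL ∋ mk far` whose intersection is
covered by the separator vertices, no typed edge inside both sides, `mk far` not a separator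
vertex. -/
structure SepFarAny (far : Fin 5) (VL VH : Set V) (F : Finset E) (z : Config E) : Prop where
  split : ∀ e, zF F z e = true → e ∈ within ends VL ∨ e ∈ within ends VH
  cap : ∀ t, t ∈ VL → t ∈ VH → ∃ i, σ i = t
  noloop : ∀ e ∈ F, ¬ (e ∈ within ends VL ∧ e ∈ within ends VH)
  rootH : ∀ k, k ≠ far → mk k ∈ VH
  farL : mk far ∈ VL
  farsep : ∀ i, σ i ≠ mk far

omit [Fintype E] [LinearOrder R] [IsStrictOrderedRing R] in
/-- A configuration below `z ∪ F` has its open edges within a side. -/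
lemma SepFarAny.split_of_le {far : Fin 5} {VL VH : Set V} {F : Finset E} {z : Config E}
    (h : SepFarAny ends mk σ far VL VH F z) {x : Config E} (hx : x ≤ zF F z) :
    ∀ e, x e = true → e ∈ within ends VL ∨ e ∈ within ends VH := fun e he =>
  h.split e (by have := hx e; rw [he] at this; exact Bool.eq_true_of_true_le this)

omit [Fintype E] [DecidableEq E] [LinearOrder R] [IsStrictOrderedRing R] in
/-- The glue relation of the sides is the glue relation of the data. -/
lemma glue_iff_glueDA (far : Fin 5) (VL VH : Set V) (x : Config E) (i j : ι) :
    glue ends VH VL σ x i j ↔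
      glueDA (rootDataA ends mk σ (withinRestr ends VH x))
        (fpG ends σ (mk far) (withinRestr ends VL x)) i j := by
  unfold glue glueDA
  have hrel : sepStep ends VH VL σ x = fun i j =>
      (rootDataA ends mk σ (withinRestr ends VH x)).ss i j = true ∨
        (fpG ends σ (mk far) (withinRestr ends VL x)).1 i j = true := by
    funext i j
    simp only [sepStep, rootDataA, fpG, decide_eq_true_eq]
  rw [hrel]

omit [Fintype E] [LinearOrder R] [IsStrictOrderedRing R] in
/-- **The glued connection is the connection**: for two distinct marks, the connection in a copy
of the support is the glued connection of its root-side data and its far pattern. -/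
theorem conn_iff_connA {far : Fin 5} {VL VH : Set V} {F : Finset E} {z : Config E}
    (h : SepFarAny ends mk σ far VL VH F z) {x : Config E} (hx : ∀ e, e ∉ F → x e = z e)
    (k l : Fin 5) (hkl : k ≠ l) :
    Conn ends x (mk k) (mk l) ↔
      connA (rootDataA ends mk σ (withinRestr ends VH x))
        (fpG ends σ (mk far) (withinRestr ends VL x)) far k l := by
  have hsp := SepFarAny.split_of_le ends mk σ h (le_zF hx)
  have hsp' : ∀ e, x e = true → e ∈ within ends VH ∨ e ∈ within ends VL := fun e he =>
    (hsp e he).symm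
  have hcap' : ∀ t, t ∈ VH → t ∈ VL → ∃ i, σ i = t := fun t h1 h2 => h.cap t h2 h1
  have hg := glue_iff_glueDA ends mk σ far VL VH x
  unfold connA
  by_cases hk : k = far
  · subst hk
    have hl : l ≠ k := fun h' => hkl h'.symm
    rw [if_pos rfl]
    have e := conn_crossG ends hsp' hcap' (h.rootH l hl) h.farL h.farsep
    have e0 : Conn ends x (mk k) (mk l) ↔ Conn ends x (mk l) (mk k) := ⟨conn_symm, conn_symm⟩
    rw [e0, e]
    simp only [reachG', hg, rootDataA, fpG, decide_eq_true_eq]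
  · rw [if_neg hk]
    by_cases hl : l = far
    · subst hl
      rw [if_pos rfl]
      rw [conn_crossG ends hsp' hcap' (h.rootH k hk) h.farL h.farsep]
      simp only [reachG', hg, rootDataA, fpG, decide_eq_true_eq]
    · rw [if_neg hl]
      rw [conn_sideG ends hsp' hcap' (h.rootH k hk) (h.rootH l hl)]
      simp only [reachG, hg, rootDataA, fpG, decide_eq_true_eq]

omit [Fintype E] [LinearOrder R] [IsStrictOrderedRing R] in
/-- **The state of a copy of the support**: the root-side data glued with the far pattern. -/
theorem st_eq_gluedAny {far : Fin 5} {VL VH : Set V} {F : Finset E} {z : Config E}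
    (h : SepFarAny ends mk σ far VL VH F z) {x : Config E} (hx : ∀ e, e ∉ F → x e = z e) :
    st ends (mk 0) (mk 1) (mk 2) (mk 3) (mk 4) x =
      gluedAny (rootDataA ends mk σ (withinRestr ends VH x))
        (fpG ends σ (mk far) (withinRestr ends VL x)) far := by
  unfold st gluedAny
  rw [decide_eq_decide.mpr (conn_iff_connA ends mk σ h hx 2 1 (by decide)),
    decide_eq_decide.mpr (conn_iff_connA ends mk σ h hx 1 0 (by decide)),
    decide_eq_decide.mpr (conn_iff_connA ends mk σ h hx 2 0 (by decide)),
    decide_eq_decide.mpr (conn_iff_connA ends mk σ h hx 1 4 (by decide)),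
    decide_eq_decide.mpr (conn_iff_connA ends mk σ h hx 2 4 (by decide)),
    decide_eq_decide.mpr (conn_iff_connA ends mk σ h hx 1 3 (by decide)),
    decide_eq_decide.mpr (conn_iff_connA ends mk σ h hx 2 3 (by decide))]

/-- The root-side kernel of a fixed pattern triple `p`: the kernel on the glued states of the three
copies, read on the root-side restriction. -/
noncomputable def rootKA (far : Fin 5) (VH : Set V) (p : Pat3G ι) :
    Config E → Config E → Config E → R :=
  fun x y w => ((KB (gluedAny (rootDataA ends mk σ (withinRestr ends VH x)) p.1 far)
    (gluedAny (rootDataA ends mk σ (withinRestr ends VH y)) p.2.1 far)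
    (gluedAny (rootDataA ends mk σ (withinRestr ends VH w)) p.2.2 far) : ℤ) : R)

omit [Fintype E] [LinearOrder R] [IsStrictOrderedRing R] in
/-- **`K₃` on the support** when one mark sits alone beyond the separator: the pattern-triple
form. -/
theorem K3_eq_sepFarAny [Fintype ι] [DecidableEq ι] {far : Fin 5} {VL VH : Set V}
    {F : Finset E} {z : Config E} (h : SepFarAny ends mk σ far VL VH F z) {x y w : Config E}
    (hx : ∀ e, e ∉ F → x e = z e) (hy : ∀ e, e ∉ F → y e = z e) (hw : ∀ e, e ∉ F → w e = z e) :
    (K3 ends (mk 0) (mk 1) (mk 2) (mk 3) (mk 4) x y w : R) =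
      ∑ p : Pat3G ι, farKG ends σ (mk far) VL p (restr (sideF ends VL F) z x)
          (restr (sideF ends VL F) z y) (restr (sideF ends VL F) z w) *
        rootKA ends mk σ far VH p (restr (sideF ends VH F) z x) (restr (sideF ends VH F) z y)
          (restr (sideF ends VH F) z w) := by
  rw [K3_eq_KB, st_eq_gluedAny ends mk σ h hx, st_eq_gluedAny ends mk σ h hy,
    st_eq_gluedAny ends mk σ h hw]
  unfold farKG rootKA
  rw [withinRestr_restr_eq ends VH hx, withinRestr_restr_eq ends VH hy,
    withinRestr_restr_eq ends VH hw, withinRestr_restr_eq ends VL hx,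
    withinRestr_restr_eq ends VL hy, withinRestr_restr_eq ends VL hw]
  set hx' := rootDataA ends mk σ (withinRestr ends VH x) with hhx
  set hy' := rootDataA ends mk σ (withinRestr ends VH y) with hhy
  set hw' := rootDataA ends mk σ (withinRestr ends VH w) with hhw
  set qx := fpG ends σ (mk far) (withinRestr ends VL x) with hqx
  set qy := fpG ends σ (mk far) (withinRestr ends VL y) with hqy
  set qw := fpG ends σ (mk far) (withinRestr ends VL w) with hqw
  have hs : (∑ p : Pat3G ι, exactG p.1 qx * exactG p.2.1 qy * exactG p.2.2 qw *
      KB (gluedAny hx' p.1 far) (gluedAny hy' p.2.1 far) (gluedAny hw' p.2.2 far)) =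
      KB (gluedAny hx' qx far) (gluedAny hy' qy far) (gluedAny hw' qw far) :=
    sum_exactG (fun p : Pat3G ι => KB (gluedAny hx' p.1 far) (gluedAny hy' p.2.1 far)
      (gluedAny hw' p.2.2 far)) (qx, qy, qw)
  rw [← hs]
  push_cast
  rfl

omit [LinearOrder R] [IsStrictOrderedRing R] in
/-- **THE TYPED ONE-FAR-MARK RULE AT A SEPARATOR OF ANY SIZE, FOR ANY FAR MARK**: sorting the
copies by their far-pattern triple,
`typedCount F z τ K₃ = (Σ_p farCount(p) · rootCount(p)) · (inert count)`. -/
theorem typedCount_eq_sepFarAny [Fintype ι] [DecidableEq ι] {far : Fin 5} {VL VH : Set V}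
    (F : Finset E) (z : Config E) (τ : E → ℕ) (h : SepFarAny ends mk σ far VL VH F z) :
    typedCount F z τ
        (K3 ends (mk 0) (mk 1) (mk 2) (mk 3) (mk 4) : Config E → Config E → Config E → R) =
      (∑ p : Pat3G ι, typedCount (sideF ends VL F) z τ (farKG ends σ (mk far) VL p) *
          typedCount (sideF ends VH F) z τ (rootKA ends mk σ far VH p)) *
        typedCount (F \ (sideF ends VL F ∪ sideF ends VH F)) z τ (fun _ _ _ => (1 : R)) := by
  set A := sideF ends VL F with hA
  set B := sideF ends VH F with hB
  set C := F \ (A ∪ B) with hC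
  have hAF : A ⊆ F := Finset.filter_subset _ _
  have hBF : B ⊆ F := Finset.filter_subset _ _
  have hAB : Disjoint A B := by
    rw [Finset.disjoint_left]
    intro e heA heB
    simp only [hA, hB, sideF, Finset.mem_filter] at heA heB
    exact h.noloop e heA.1 ⟨heA.2, heB.2⟩
  have hABF : A ∪ B ⊆ F := Finset.union_subset hAF hBF
  have hAC : Disjoint A C :=
    Finset.disjoint_of_subset_left Finset.subset_union_left Finset.disjoint_sdiff
  have hBC : Disjoint B C :=
    Finset.disjoint_of_subset_left Finset.subset_union_right Finset.disjoint_sdiff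
  have hF : A ∪ B ∪ C = F := Finset.union_sdiff_of_subset hABF
  have hker : typedCount F z τ
      (K3 ends (mk 0) (mk 1) (mk 2) (mk 3) (mk 4) : Config E → Config E → Config E → R) =
      typedCount F z τ (fun x y w => ∑ p : Pat3G ι,
        farKG ends σ (mk far) VL p (restr A z x) (restr A z y) (restr A z w) *
          rootKA ends mk σ far VH p (restr B z x) (restr B z y) (restr B z w)) := by
    refine typedCount_congr_on_support F z τ fun x y w hc _ => ?_
    exact K3_eq_sepFarAny ends mk σ h (fun e he => (hc e he).1)
      (fun e he => (hc e he).2.1) (fun e he => (hc e he).2.2)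
  have hm : ∀ p : Pat3G ι, typedCount (A ∪ B ∪ C) z τ (fun x y w =>
      farKG ends σ (mk far) VL p (restr A z x) (restr A z y) (restr A z w) *
        rootKA ends mk σ far VH p (restr B z x) (restr B z y) (restr B z w)) =
      typedCount A z τ (farKG ends σ (mk far) VL p) *
        typedCount B z τ (rootKA ends mk σ far VH p) *
        typedCount C z τ (fun _ _ _ => (1 : R)) := fun p =>
    typedCount_mul_three A B C hAB hAC hBC z τ (farKG ends σ (mk far) VL p)
      (rootKA ends mk σ far VH p : Config E → Config E → Config E → R)
  rw [hF] at hm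
  rw [hker, typedCount_sum, Finset.sum_congr rfl (fun p _ => hm p), Finset.sum_mul]

end Main

/-! ## The rule on the realised orbits -/

section Rule

open Classical

variable {V : Type*} {E : Type*} {ι : Type*} [Fintype E] [DecidableEq E] [Fintype ι]
  [DecidableEq ι] {R : Type*} [Field R] [LinearOrder R] [IsStrictOrderedRing R]
variable (ends : E → Sym2 V) (mk : Fin 5 → V) (σ : ι → V)

/-- The `S₃`-orbit sum of the root-side counts of a pattern triple (the six copy permutations). -/
noncomputable def orbitRootA (far : Fin 5) (VH : Set V) (B : Finset E) (z : Config E)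
    (τ : E → ℕ) (p : Pat3G ι) : R :=
  orbitSumG (fun q => typedCount B z τ (rootKA ends mk σ far VH q)) p

omit [LinearOrder R] [IsStrictOrderedRing R] in
/-- Pairing the far counts with a permuted root count gives the same sum. -/
lemma sum_far_root_permA (far : Fin 5) (VL VH : Set V) (A B : Finset E) (z : Config E)
    (τ : E → ℕ) (f : Pat3G ι → Pat3G ι) (hf : Function.Bijective f)
    (hσ : ∀ p, typedCount A z τ
        (farKG ends σ (mk far) VL (f p) : Config E → Config E → Config E → R) =
      typedCount A z τ (farKG ends σ (mk far) VL p)) :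
    (∑ p : Pat3G ι,
        typedCount A z τ (farKG ends σ (mk far) VL p : Config E → Config E → Config E → R) *
          typedCount B z τ (rootKA ends mk σ far VH (f p))) =
      ∑ p : Pat3G ι,
        typedCount A z τ (farKG ends σ (mk far) VL p : Config E → Config E → Config E → R) *
          typedCount B z τ (rootKA ends mk σ far VH p) := by
  refine Fintype.sum_bijective f hf _ _ fun p => ?_
  rw [hσ p]

/-- **Row 2′TRI when any one mark sits alone behind a separator of any size, from the REALISED
orbits**: it suffices that the `S₃`-orbit sums of the glued root-side counts be nonnegative on the
pattern triples whose far count is nonzero. -/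
theorem typedCount_nonneg_of_sepFarAny_realised {far : Fin 5} {VL VH : Set V} (F : Finset E)
    (z : Config E) (τ : E → ℕ) (hτ : ∀ e ∈ F, τ e = 1 ∨ τ e = 2)
    (h : SepFarAny ends mk σ far VL VH F z)
    (hroot : ∀ p : Pat3G ι,
      typedCount (sideF ends VL F) z τ
          (farKG ends σ (mk far) VL p : Config E → Config E → Config E → R) ≠ 0 →
      (0 : R) ≤ orbitRootA ends mk σ far VH (sideF ends VH F) z τ p) :
    0 ≤ typedCount F z τ
      (K3 ends (mk 0) (mk 1) (mk 2) (mk 3) (mk 4) : Config E → Config E → Config E → R) := by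
  rw [typedCount_eq_sepFarAny ends mk σ F z τ h]
  have hτA : ∀ e ∈ sideF ends VL F, τ e = 1 ∨ τ e = 2 :=
    fun e he => hτ e (Finset.filter_subset _ _ he)
  refine mul_nonneg ?_ (typedCount_nonneg_of_nonneg _ _ _ fun _ _ _ => zero_le_one)
  refine nonneg_of_orbit_sumsG
    (fun p => typedCount (sideF ends VL F) z τ (farKG ends σ (mk far) VL p))
    (fun p => typedCount (sideF ends VH F) z τ (rootKA ends mk σ far VH p))
    (fun p => farCountG_nonneg ends σ (mk far) VL _ z τ p) ?_ ?_ ?_ ?_ ?_ hroot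
  · exact sum_far_root_permA ends mk σ far VL VH _ _ z τ _
      (Function.Involutive.bijective fun _ => rfl)
      (fun p => farCountG_swap12 ends σ (mk far) VL _ z τ p)
  · exact sum_far_root_permA ends mk σ far VL VH _ _ z τ _
      (Function.Involutive.bijective fun _ => rfl)
      (fun p => farCountG_swap23 ends σ (mk far) VL _ z τ hτA p)
  · exact sum_far_root_permA ends mk σ far VL VH _ _ z τ _
      (Function.Involutive.bijective fun _ => rfl)
      (fun p => farCountG_swap13 ends σ (mk far) VL _ z τ hτA p)
  · exact sum_far_root_permA ends mk σ far VL VH _ _ z τ _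
      (Function.bijective_iff_has_inverse.mpr
        ⟨fun p => (p.2.2, p.1, p.2.1), fun _ => rfl, fun _ => rfl⟩)
      (fun p => farCountG_cyc ends σ (mk far) VL _ z τ hτA p)
  · exact sum_far_root_permA ends mk σ far VL VH _ _ z τ _
      (Function.bijective_iff_has_inverse.mpr
        ⟨fun p => (p.2.1, p.2.2, p.1), fun _ => rfl, fun _ => rfl⟩)
      (fun p => farCountG_cyc' ends σ (mk far) VL _ z τ hτA p)

/-- **Row 2′TRI when any one mark sits alone behind a separator of any size, from the REAL
orbits**: it suffices that the `S₃`-orbit sums of the glued root-side counts be nonnegative on the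
triples of real far patterns (the set partitions of the separator vertices and the far mark) — a
finite root-side statement, no reference to the far counts. -/
theorem typedCount_nonneg_of_sepFarAny_real {far : Fin 5} {VL VH : Set V} (F : Finset E)
    (z : Config E) (τ : E → ℕ) (hτ : ∀ e ∈ F, τ e = 1 ∨ τ e = 2)
    (h : SepFarAny ends mk σ far VL VH F z)
    (hroot : ∀ p : Pat3G ι, FPrealG p.1 → FPrealG p.2.1 → FPrealG p.2.2 →
      (0 : R) ≤ orbitRootA ends mk σ far VH (sideF ends VH F) z τ p) :
    0 ≤ typedCount F z τ
      (K3 ends (mk 0) (mk 1) (mk 2) (mk 3) (mk 4) : Config E → Config E → Config E → R) := by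
  refine typedCount_nonneg_of_sepFarAny_realised ends mk σ F z τ hτ h fun p hp => ?_
  obtain ⟨h1, h2, h3⟩ := real_of_farCountG_ne_zero ends σ (mk far) VL _ z τ p hp
  exact hroot p h1 h2 h3

end Rule

end RootBridge

end CovForm

end Summit.Ventures.PercRepro2
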